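import Literature.NumberTheory.EllipticCurves.YanZhu2026.CyclotomicMainTheoremRational
import Literature.NumberTheory.EllipticCurves.BSDSelmerPConverseRankZeroProofs
import Literature.NumberTheory.EllipticCurves.Greenberg1999.RankZeroEulerCharacteristicOddPrimeProofs
import Literature.NumberTheory.EllipticCurves.KuriharaNumberKimStructure
import Literature.NumberTheory.EllipticCurves.LeadingTerm
import HarnessLib

/-!
# Yan–Zhu 2026, Theorem 5.11 (= Cor. 1.4; arXiv v2: Thm. 4.15): the `p`-converse and the rank
# equivalences (1) ⇔ (2) ⇔ (3) in rank `≤ 1` at an ODD good ordinary prime with `ρ̄_{E,p}`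
# irreducible — the EQUIVALENCE clauses (the `p`-part-of-BSD clause is `YanZhu2026/PPartBSD.lean`)

Source: Xiaojun Yan, Xiuwu Zhu, *Main conjectures for non-CM elliptic curves at good ordinary
primes*, J. Algebra **693** (2026) 372–402, doi:10.1016/j.jalgebra.2026.01.016 = arXiv:2412.20078.
Locators below are those of arXiv **v4** (2026-01-23, the revision carrying the journal DOI; TeX
`main.tex`, e-print SHA-256 `2ebe33f2…fb40`, held at
`run/shared/lean/b2b/bsd-rank1-residual/b2b-bsdres-lit/g98/eprints/yz_v4/`): **Theorem 5.11**
(§5.3 "BSD conjectures", l.1319–1349) = **Corollary 1.4** (§1.1, l.384–391); concordance with the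
store text `paper:arxiv-2412.20078` (= arXiv v2, 2025-01-03): Thm. 5.11 = v2 Thm. 4.15 (§4.6), Thm.
5.2 = v2 Thm. 4.9, Thm. 5.7 = v2 Thm. 4.12 (content of 5.11 unchanged between v2 and v4, lit GEN 98
diff read). Bib key `YanZhu2024MainConjNonCM` (the key used by `YanZhu2026/PPartBSD.lean`).

## What the tree already had, and what this file adds

* `YanZhu2026/PPartBSD.lean` vendors the LAST clause of Thm. 5.11 (the `p`-part of BSD under (Im)).
* `KuriharaNumberKimStructure.lean` vendors the (2) ⇒ (3) implication at `r = 1` SPECIALISED to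
  `p ≥ 5` and `ρ̄_{E,p}` SURJECTIVE (`yanZhu_analyticRank_eq_one_of_selmerCorank_eq_one`, "Weaker
  than print"), the hypotheses of the crux it grounds.
* THIS FILE vendors the equivalence part of Thm. 5.11 AS PRINTED — `p > 2` (so `p = 3` is allowed),
  good ORDINARY reduction at `p`, NO condition on the conductor, NO image condition beyond the
  paper's standing irreducibility of `ρ̄_{E,p}`, BOTH `r = 0` and `r = 1` — as ONE named fact
  `thm511_analyticRank_eq_of_selmerCorank_eq` ((2) ⇒ (3), the `p`-converse; D-0014, nothing
  asserted), and PROVES around it: the full equivalence (1) ⇔ (2) ⇔ (3) modulo the tree's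
  Gross–Zagier–Kolyvagin fact (`thm511_tfae_of_gzk`), the old specialised fact as a corollary
  (`yanZhu_analyticRank_eq_one_of_selmerCorank_eq_one_of_thm511`), and — re-assembling the printed
  proof of the `r = 0` leg in the kernel — the `r = 0` case of the fact from the paper's own Theorem
  5.2 (rational cyclotomic main conjecture, tree fact `thm49_charIdeal_eq_padicLFunction`) plus
  modularity, Perrin-Riou–Schneider and the Mazur–Tate `σ`-function at odd `p`
  (`thm511_rankZero_of_thm52`), valid at EVERY odd good ordinary `p`, `p = 3` included.

## The printed statement (v4 l.1316–1332, verbatim) and its standing hypotheses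

§5.3: "Let `E/ℚ` be an elliptic curve of conductor `N`, and let `p > 2` be a prime such that `E` has
good ordinary reduction at `p`. **Theorem 5.11.** Let `r ≤ 1` be an integer. The following
statements are equivalent: (1) `rank_ℤ E(ℚ) = r` and `#Ш(E/ℚ) < ∞`; (2) `corank_{ℤ_p} Sel_{p^∞}(E/ℚ)
= r`; (3) `ord_{s=1} L(E/ℚ, s) = r`. Under any of the above conditions, if condition (Im) also
holds, then the `p`-part of the BSD formula for `E` is valid […]." Cor. 1.4 (l.384–391): "Let `E/ℚ`
be an elliptic curve of conductor `N`, and let `p ∤ 2N` be a prime at which `E` has good ordinary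
reduction. If `r ≤ 1`, then the following are equivalent: (1) `corank_{ℤ_p} Sel_{p^∞}(E/ℚ) = r`;
(2) `ord_{s=1} L(E/ℚ, s) = r`." Printed proof (l.1335–1343): "(1) ⇒ (2) is immediate. (3) ⇒ (1) is
established by the work of Gross–Zagier [GZ] and Kolyvagin [Kol]. For (2) ⇒ (3), one can choose an
imaginary quadratic field `K` such that `ord_{s=1} L(E^K, s) ≤ 1` and `(E, K)` satisfies the
Heegner hypothesis, as shown in [FH]. Analogously to [Wan, Theorem 1.9], by applying descent
arguments to the rational part of Theorem 5.7 (2) and using the Gross–Zagier formula, we obtain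
`corank_{ℤ_p} Sel_{p^∞}(E/K) = 1 ⇒ ord_{s=1} L(E/K, s) = 1`, thus establishing (2) ⇒ (3)."

IRREDUCIBILITY (faithfulness note, recorded for the referee desks). §5.3 and Cor. 1.4 do not
re-state it, but the abstract does ("Let `E/ℚ` be an elliptic curve and `p > 2` be a prime of good
ordinary reduction for `E`. Assume that the residue representation associated with `(E, p)` is
irreducible. … As applications, we prove more general cases of `p`-converse theorem and `p`-part
BSD formula", l.269–272), and every input of the printed proof is stated under it: Thm. 5.7 (2)
under §5.2's "Assume that the residual representation `ρ̄_E|_{G_K}` is irreducible" (l.1190), Thm.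
5.2 under §5.1's "Assume that `ρ̄_E : G_ℚ → Aut(E[p])` is irreducible" (l.1062). The fact below
therefore carries `ρ̄_{E,p}` irreducible as an explicit hypothesis (`hirr`): it is the statement the
paper PROVES (never stronger than the source); read literally without (irr), Thm. 5.11 / Cor. 1.4
would also cover Eisenstein primes (e.g. `p = 3` with a rational `3`-isogeny), which the paper does
not treat (those are Castella–Grossi–Lee–Skinner 2022 / Castella–Grossi–Skinner 2025 territory).

Transcription dictionary (tree vocabulary, as in `YanZhu2026/PPartBSD.lean`): `W` a globally
minimal model of `E` (to read `a_p = W.frobeniusTrace p`), `[W.IsElliptic]`; "`p > 2`" = `3 ≤ p`;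
good reduction `W.HasGoodReductionAtPrime p`; ordinary `¬ (p : ℤ) ∣ W.frobeniusTrace p`; (irr) =
`W.HasIrreducibleModPGaloisRep p`; `corank_{ℤ_p} Sel_{p^∞}(E/ℚ) = W.selmerCorank p`; `ord_{s=1}
L(E/ℚ, s) = W.analyticRank`; `rank_ℤ E(ℚ) = W.mordellWeilRank`; `#Ш(E/ℚ) < ∞` = `Finite W.sha`.

Status: REFEREED and published. Cell documentation flag on a proof-level input at `p = 3`
(`YZ26@3-BF-ERL-Ohta`, referee rulings R9.1/R10.1, wording in `YanZhu2026/PPartBSD.lean`): Thm. 4.7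
(the Beilinson–Flach equivalence of the two-variable main conjectures) is printed "essentially
[BSTW, Proposition 9.18]" (a preprint) "See also [BCS, Prop. 4.1.3] and [CGS, Prop. 4.2.1]"; the
`Λ`-adic explicit reciprocity laws behind it are in print for `p ≥ 5`. The (2) ⇒ (3) leg uses in
addition Thm. 5.7 (2) (rational Heegner point main conjecture, from [CGS, Thm. 6.5.2]) and
Friedberg–Hoffstein. Nothing is asserted: consumers take `(h : thm511_analyticRank_eq_of_selmerCorank_eq)`.

## References

* X. Yan, X. Zhu, J. Algebra 693 (2026) 372–402 = arXiv:2412.20078v4: Thm. 5.11 (§5.3, l.1319–1349),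
  Cor. 1.4 (l.384–391), abstract (l.269–272), Thm. 5.2 (l.1072–1083), Thm. 5.7 (l.1217–1242);
  = arXiv v2: Thm. 4.15 (§4.6), Cor. 1.4, Thm. 4.9, Thm. 4.12.
* B. Gross, D. Zagier, Invent. Math. 84 (1986); V. Kolyvagin, *Euler systems* (1990); stated as
  Darmon, CBMS 101 (2004), Thm. 3.22 — tree fact `rank_eq_analyticRank_of_analyticRank_le_one`.
* R. Greenberg, LNM 1716 (1999), §1 pp. 54–57 (corank identity), Thm. 4.1 — tree theorems
  `selmerCorank_eq_mordellWeilRank_add_holds`, `greenberg_rankZero_of_Schneider1985_odd`.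
-/

noncomputable section

open scoped Classical MatrixGroups ModularForm

open CongruenceSubgroup WeierstrassCurve Literature.NumberTheory.EllipticCurves
  Literature.NumberTheory.EllipticCurves.ModularForms

namespace Literature.NumberTheory.EllipticCurves.YanZhu2026

/-- **Yan–Zhu, J. Algebra 693 (2026), Theorem 5.11 (= Cor. 1.4; arXiv v2 Thm. 4.15), implication
(2) ⇒ (3) — the `p`-converse in rank `≤ 1` at an odd good ordinary prime with `ρ̄_{E,p}`
irreducible, any conductor.** As printed (arXiv v4 §5.3, l.1316–1326): "Let `E/ℚ` be an elliptic
curve of conductor `N`, and let `p > 2` be a prime such that `E` has good ordinary reduction at `p`.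
Theorem 5.11. Let `r ≤ 1` be an integer. The following statements are equivalent: (1) `rank_ℤ E(ℚ)
= r` and `#Ш(E/ℚ) < ∞`; (2) `corank_{ℤ_p} Sel_{p^∞}(E/ℚ) = r`; (3) `ord_{s=1} L(E/ℚ, s) = r`",
under the paper's standing assumption (abstract, l.270; §5.1 l.1062; §5.2 l.1190) "the residual
representation `ρ̄_E : G_ℚ → Aut(E[p])` is irreducible" (kept explicit as `hirr`; see the module
docstring, IRREDUCIBILITY). Transcription: `W` a globally minimal model of `E`; `3 ≤ p` (`hp`);
good (`hgood`) ordinary (`hord : p ∤ a_p`) reduction at `p`; `ρ̄_{E,p}` irreducible (`hirr`);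
`r ≤ 1` a natural number (`hr`; (2) forces `r ≥ 0`); hypothesis (2) `W.selmerCorank p = r`;
conclusion (3) `W.analyticRank = r`. The converse (3) ⇒ (2) and the clauses with (1) are
Gross–Zagier–Kolyvagin and the corank identity (`thm511_tfae_of_gzk` below). Compared with the
tree's `yanZhu_analyticRank_eq_one_of_selmerCorank_eq_one` (same source, specialised to `p ≥ 5`,
`ρ̄_{E,p}` surjective, `r = 1`) this is the printed generality: `p = 3` allowed, (irr) only, both
`r = 0` and `r = 1` (`yanZhu_analyticRank_eq_one_of_selmerCorank_eq_one_of_thm511`).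
[cite: YanZhu2024MainConjNonCM, Thm. 5.11 (2)⇒(3) (§5.3, arXiv:2412.20078v4 TeX l.1319–1343) = Cor. 1.4 (l.384–391); = arXiv v2 Thm. 4.15 (§4.6)] -/
def thm511_analyticRank_eq_of_selmerCorank_eq : Prop :=
  ∀ (W : WeierstrassCurve ℚ) [W.IsElliptic] [W.IsGloballyMinimal] (p : ℕ) [Fact p.Prime]
    (_hp : 3 ≤ p) (_hgood : W.HasGoodReductionAtPrime p) (_hord : ¬ (p : ℤ) ∣ W.frobeniusTrace p)
    (_hirr : W.HasIrreducibleModPGaloisRep p) (r : ℕ) (_hr : r ≤ 1)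
    (_hSel : W.selmerCorank p = r), W.analyticRank = r

/-! ### The equivalence (1) ⇔ (2) ⇔ (3) modulo Gross–Zagier–Kolyvagin -/

/-- (1) ⇒ (2) ("immediate", l.1335): `rank_ℤ E(ℚ) = r` and `Ш(E/ℚ)` finite give
`corank_{ℤ_p} Sel_{p^∞}(E/ℚ) = r`, by the corank identity `corank Sel_{p^∞} = rank + corank Ш[p^∞]`
(Greenberg 1999 §1; tree theorem `selmerCorank_eq_mordellWeilRank_add_holds`) and `corank Ш[p^∞] = 0`
for finite `Ш`. Unconditional, any prime, any `r`. [cite: Greenberg1999LNM, §1 pp. 54–57] -/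
theorem selmerCorank_eq_of_mordellWeilRank_eq_of_finite_sha (W : WeierstrassCurve ℚ) [W.IsElliptic]
    (p : ℕ) [Fact p.Prime] {r : ℕ} (hrk : W.mordellWeilRank = r) (hfin : Finite W.sha) :
    W.selmerCorank p = r := by
  haveI := hfin
  haveI : Finite (AddCommGroup.primaryComponent W.sha p) := inferInstance
  have h0 : W.shaCorank p = 0 := (finite_primaryComponent_sha_iff_shaCorank_eq_zero W p).mp this
  rw [W.selmerCorank_eq_mordellWeilRank_add_holds p, hrk, h0, add_zero]

/-- **Theorem 5.11, the three equivalences, for `r ≤ 1`**, from the fact ((2) ⇒ (3)) and the tree's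
Gross–Zagier–Kolyvagin fact `rank_eq_analyticRank_of_analyticRank_le_one` ((3) ⇒ (1), "established
by the work of Gross–Zagier and Kolyvagin", l.1337), with (1) ⇒ (2) the corank identity: at an odd
good ordinary `p` with `ρ̄_{E,p}` irreducible, `(rank E(ℚ) = r ∧ Ш finite) ↔ corank_{ℤ_p} Sel_{p^∞}(E/ℚ) = r`
and `corank_{ℤ_p} Sel_{p^∞}(E/ℚ) = r ↔ ord_{s=1} L(E, s) = r`.
[cite: YanZhu2024MainConjNonCM, Thm. 5.11 and its proof (arXiv v4 l.1319–1343)] [cite: Darmon2004, Thm. 3.22] -/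
theorem thm511_tfae_of_gzk (h : thm511_analyticRank_eq_of_selmerCorank_eq)
    (hGZK : rank_eq_analyticRank_of_analyticRank_le_one)
    (W : WeierstrassCurve ℚ) [W.IsElliptic] [W.IsGloballyMinimal] (p : ℕ) [Fact p.Prime]
    (hp : 3 ≤ p) (hgood : W.HasGoodReductionAtPrime p) (hord : ¬ (p : ℤ) ∣ W.frobeniusTrace p)
    (hirr : W.HasIrreducibleModPGaloisRep p) (r : ℕ) (hr : r ≤ 1) :
    ((W.mordellWeilRank = r ∧ Finite W.sha) ↔ W.selmerCorank p = r) ∧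
      (W.selmerCorank p = r ↔ W.analyticRank = r) := by
  have h23 : W.selmerCorank p = r → W.analyticRank = r := h W p hp hgood hord hirr r hr
  have h31 : W.analyticRank = r → W.mordellWeilRank = r ∧ Finite W.sha := fun h3 => by
    obtain ⟨hrk, hfin⟩ := hGZK W (by omega)
    exact ⟨hrk.trans h3, hfin⟩
  have h12 : W.mordellWeilRank = r ∧ Finite W.sha → W.selmerCorank p = r := fun h1 =>
    selmerCorank_eq_of_mordellWeilRank_eq_of_finite_sha W p h1.1 h1.2
  exact ⟨⟨h12, fun h2 => h31 (h23 h2)⟩, ⟨h23, fun h3 => h12 (h31 h3)⟩⟩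

/-- **The tree's specialised fact follows**: `yanZhu_analyticRank_eq_one_of_selmerCorank_eq_one`
(`p ≥ 5` good ordinary, `ρ̄_{E,p}` surjective, `corank = 1 ⇒ ord = 1`) is the case `r = 1`, `p ≥ 5`
of Thm. 5.11 (2) ⇒ (3), surjectivity giving irreducibility
(`hasIrreducibleModPGaloisRep_of_hasSurjectiveModNGaloisRep`).
[cite: YanZhu2024MainConjNonCM, Cor. 1.4 / Thm. 5.11 (2)⇒(3) at r = 1] -/
theorem yanZhu_analyticRank_eq_one_of_selmerCorank_eq_one_of_thm511
    (h : thm511_analyticRank_eq_of_selmerCorank_eq) :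
    yanZhu_analyticRank_eq_one_of_selmerCorank_eq_one := by
  intro W _ _ p _ hp hgood hord hsurj h1
  haveI : NeZero (p : ℚ) := ⟨Nat.cast_ne_zero.mpr (Fact.out : p.Prime).ne_zero⟩
  exact h W p (by omega) hgood hord
    (hasIrreducibleModPGaloisRep_of_hasSurjectiveModNGaloisRep W p hsurj) 1 le_rfl h1

/-! ### The `r = 0` leg re-assembled from the paper's Theorem 5.2 (rational cyclotomic main
conjecture) — valid at every odd good ordinary `p`, `p = 3` included -/

/-- **`Sel_{p^∞}(E/ℚ)` finite ⟹ `L(E, 1) ≠ 0` at an ODD good ordinary `p` with `ρ̄_{E,p}`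
irreducible, below Yan–Zhu Thm. 5.2 (rational part; tree fact `thm49_charIdeal_eq_padicLFunction`:
`char_Λ X(E/ℚ_∞) = (g)`, `ι g = p^k · L_p(f, α)`), modularity (`hmod`), Perrin-Riou–Schneider at odd
`p` (`hS`) and the Mazur–Tate `σ`-function at odd `p` (`hMT`).** The argument of
`entireLFunction_one_ne_zero_of_finite_selmerGroupPInfty_of_mainConjecture` (Greenberg, LNM 1716, §1
pp. 65–66) with its `p ≥ 5` inputs replaced by their odd-prime forms: finiteness of the Selmer group
gives `g(0) ≠ 0` (Greenberg's Thm. 4.1, tree theorem `greenberg_rankZero_of_Schneider1985_odd`), so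
`L_p(f, α)(0) = (1 − α⁻¹)² [0]⁺_f ≠ 0` and `L(E, 1) = [0]⁺_f Ω⁺_f ≠ 0`. This is the descent the
printed proof of Thm. 5.11 points to for `r = 0` ("follows from … Theorem 5.2, combined with descent
arguments (see [SU14, Section 3.6.1])", l.1345, there for the `p`-part; the rank statement needs
only the rational part). [cite: YanZhu2024MainConjNonCM, Thm. 5.2 (arXiv v4 l.1072–1083) and proof of Thm. 5.11 (l.1345)]
[cite: GreenbergLNM1716, §1 pp. 65–66 and Thm. 4.1] -/
theorem entireLFunction_one_ne_zero_of_finite_selmerGroupPInfty_of_thm52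
    (hYZ : thm49_charIdeal_eq_padicLFunction) (hmod : exists_isNewformOf)
    (hS : Schneider1985_order_charGenerator_odd) (hMT : mazur_tate_sigma_exists_odd)
    (W : WeierstrassCurve ℚ) [W.IsElliptic] [W.IsGloballyMinimal] (p : ℕ) [Fact p.Prime]
    (hp : 3 ≤ p) (hgood : W.HasGoodReductionAtPrime p) (hord : ¬ (p : ℤ) ∣ W.frobeniusTrace p)
    (hirr : W.HasIrreducibleModPGaloisRep p) (hSel : Finite (W.selmerGroupPInfty p)) :
    W.entireLFunction 1 ≠ 0 := by
  have hpP : p.Prime := Fact.out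
  have hp2 : p ≠ 2 := by omega
  have hordp : IsOrdinaryAt W p := ⟨hgood, hord⟩
  -- modularity: the newform `f` of `E`
  haveI : NeZero (W.conductorNorm ℤ) := ⟨(W.conductorNorm_pos_holds).ne'⟩
  obtain ⟨f, hf⟩ := hmod W
  -- the cyclotomic setting and the Iwasawa module `X = X(E/ℚ_∞)`
  obtain ⟨κ, hκ, γ, hγ, hγ'⟩ := exists_isCyclotomic_isTopGenerator_isCyclotomicVariable_holds p
  obtain ⟨D⟩ := W.nonempty_selmerDualData_holds κ γ hγ
  haveI : Module.Finite (IwasawaAlgebra p) D.X := D.module_finite_holds hγ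
  -- (1) Thm. 5.2, rational part: `X` torsion, `char X = (g)`, `ι g = p^k · L_p(f, α)`
  obtain ⟨hX, g, k, hchar, hιg⟩ := hYZ W p κ γ f hp hgood hord hirr hκ hγ hγ' hf D
  -- (2) Greenberg's Thm. 4.1 at odd `p`: `g(0) · #E(ℚ)(p)² = u p^v Np² #Sel`
  obtain ⟨u, hu⟩ := greenberg_rankZero_of_Schneider1985_odd hS hMT W p hp2 hgood hord κ γ hκ hγ
    hγ' D hX g hchar hSel
  haveI := hSel
  haveI : NeZero p := ⟨hpP.ne_zero⟩
  have hNp0 : (Nat.card (AddCommGroup.primaryComponent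
      ((integralModelInt W).map (Int.castRingHom (ZMod p))).toAffine.Point p) : ℚ_[p]) ≠ 0 := by
    exact_mod_cast Nat.card_pos.ne'
  have hSel0 : (Nat.card (W.selmerGroupPInfty p) : ℚ_[p]) ≠ 0 := by
    exact_mod_cast Nat.card_pos.ne'
  have hp0 : (p : ℚ_[p]) ≠ 0 := Nat.cast_ne_zero.mpr hpP.ne_zero
  have hg0 : ((PowerSeries.constantCoeff g : ℤ_[p]) : ℚ_[p]) ≠ 0 := by
    intro h0
    rw [h0, zero_mul] at hu
    exact (mul_ne_zero (mul_ne_zero (mul_ne_zero (coe_units_ne_zero p u) (pow_ne_zero _ hp0))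
      (pow_ne_zero 2 hNp0)) hSel0) hu.symm
  -- (3) interpolation: `g(0) = p^k · (1 - α⁻¹)² · [0]⁺_f`, so `[0]⁺_f ≠ 0`
  have hc : ((PowerSeries.constantCoeff g : ℤ_[p]) : ℚ_[p]) =
      (p : ℚ_[p]) ^ k * ((1 - (unitRoot W p : ℚ_[p])⁻¹) ^ 2 * ((ratPlusSymbol f 0 : ℚ) : ℚ_[p])) := by
    rw [← constantCoeff_iwasawaToPowerSeries p g, hιg, map_mul, PowerSeries.constantCoeff_C,
      constantCoeff_padicLFunction_unitRoot hordp hf]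
  have hs0 : (ratPlusSymbol f 0 : ℚ) ≠ 0 := by
    intro h0
    apply hg0
    rw [hc, h0]
    simp
  -- (4) `L(E, 1) = [0]⁺_f · Ω⁺_f` with `Ω⁺_f > 0`
  have hpos : 0 < plusPeriod f := IsNewform0.plusPeriod_pos_holds hf.1 hf.coeffField_eq_bot
  rw [hf.entireLFunction_one_eq, Complex.ofReal_ne_zero]
  exact mul_ne_zero (by exact_mod_cast hs0) hpos.ne'

/-- **Theorem 5.11 (2) ⇒ (3) at `r = 0`, in the kernel from the paper's own inputs** (Thm. 5.2
rational part `hYZ`, modularity `hmod`, Perrin-Riou–Schneider `hS` and Mazur–Tate `hMT` at odd `p`):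
for `E/ℚ` with globally minimal model `W`, `p ≥ 3` good ordinary with `ρ̄_{E,p}` irreducible,
`corank_{ℤ_p} Sel_{p^∞}(E/ℚ) = 0 ⟹ ord_{s=1} L(E, s) = 0`. The `r = 1` leg (descent over a
Friedberg–Hoffstein field from the rational Heegner point main conjecture, Thm. 5.7 (2)) is not
re-assembled here; its `p ≥ 5`, `ρ̄` onto form is assembled in `BSDSelmerPConverseYanZhu*Proofs`.
[cite: YanZhu2024MainConjNonCM, Thm. 5.11 (2)⇒(3), r = 0, with Thm. 5.2 (arXiv v4 l.1072–1083, l.1345)]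
[cite: GreenbergLNM1716, §1 pp. 65–66] -/
theorem thm511_rankZero_of_thm52 (hYZ : thm49_charIdeal_eq_padicLFunction)
    (hmod : exists_isNewformOf) (hS : Schneider1985_order_charGenerator_odd)
    (hMT : mazur_tate_sigma_exists_odd)
    (W : WeierstrassCurve ℚ) [W.IsElliptic] [W.IsGloballyMinimal] (p : ℕ) [Fact p.Prime]
    (hp : 3 ≤ p) (hgood : W.HasGoodReductionAtPrime p) (hord : ¬ (p : ℤ) ∣ W.frobeniusTrace p)
    (hirr : W.HasIrreducibleModPGaloisRep p) (h0 : W.selmerCorank p = 0) :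
    W.analyticRank = 0 :=
  analyticRank_eq_zero_of_entireLFunction_one_ne_zero W
    (entireLFunction_one_ne_zero_of_finite_selmerGroupPInfty_of_thm52 hYZ hmod hS hMT W p hp hgood
      hord hirr ((finite_selmerGroupPInfty_iff_selmerCorank_eq_zero W p).2 h0))

/-- **Contrapositive at `r = 0`: `L(E, 1) = 0 ⟹ corank_{ℤ_p} Sel_{p^∞}(E/ℚ) ≥ 1`** at an odd good
ordinary `p` with `ρ̄_{E,p}` irreducible, below the same four inputs.
[cite: YanZhu2024MainConjNonCM, Thm. 5.2 and Thm. 5.11 (arXiv v4 l.1072–1083, l.1319–1345)] [cite: GreenbergLNM1716, §1 p. 65] -/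
theorem one_le_selmerCorank_of_entireLFunction_one_eq_zero_of_thm52
    (hYZ : thm49_charIdeal_eq_padicLFunction) (hmod : exists_isNewformOf)
    (hS : Schneider1985_order_charGenerator_odd) (hMT : mazur_tate_sigma_exists_odd)
    (W : WeierstrassCurve ℚ) [W.IsElliptic] [W.IsGloballyMinimal] (p : ℕ) [Fact p.Prime]
    (hp : 3 ≤ p) (hgood : W.HasGoodReductionAtPrime p) (hord : ¬ (p : ℤ) ∣ W.frobeniusTrace p)
    (hirr : W.HasIrreducibleModPGaloisRep p) (hL : W.entireLFunction 1 = 0) :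
    1 ≤ W.selmerCorank p := by
  by_contra hc
  have h0 : W.selmerCorank p = 0 := by omega
  exact entireLFunction_one_ne_zero_of_finite_selmerGroupPInfty_of_thm52 hYZ hmod hS hMT W p hp
    hgood hord hirr ((finite_selmerGroupPInfty_iff_selmerCorank_eq_zero W p).2 h0) hL

end Literature.NumberTheory.EllipticCurves.YanZhu2026

end
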